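import Literature.RepresentationTheory.Ichino2022.ExplicitLineModel
import Literature.RingTheory.MvPolynomial.TorusScaling

/-!
# Ichino (2022) Lemma 7.10 as a THEOREM of the explicit model `ℂ[z₁, z₂, w]` of `(U(1), U(2,1))` — the dictionary instance

Companion of `Literature.RepresentationTheory.Ichino2022.ExplicitLineModel` (the model, its harmonics and the
classification `isHWVector_iff` of the joint harmonic highest-weight vectors).  Here: the `FockHarmonics` dictionary
`explicitLine S hr` of the explicit model for a datum with `(p,q;r,s) = (1,0;2,1)` — `corresponds μ μ′` iff a joint
harmonic highest-weight vector has the polynomial weights `(μ; μ′)` MINUS the printed vacuum shifts `(r−s)/2 + m₀/2`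
(on `U(W)`) and `((p−q)/2; (q−p)/2) + n₀/2` (on `K′ = U(2) × U(1)`; the `U(1)_V` weight is minus the `w`-degree), so that
ONE instance serves every choice of the splitting exponents `(m₀, n₀)` — and the theorem
**`lemma_7_10_explicitLine : (explicitLine S hr).Lemma_7_10`**: for this signature [Ich22] Lemma 7.10 is PROVED on the
explicit model (parameters of the lemma that occur: the vacuum, `p⁺ = 1` with `a₁ = a ≥ 1` ↔ `z₁^a`, `p⁻ = 1` with
`b₁ = −d ≤ −1` ↔ `w^d`).

## References
* A. Ichino, Adv. Math. 398 (2022) 108188, §4.1, §7.5 Lemma 7.10. [Ichino2022ThetaReal]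
-/

namespace Literature.RepresentationTheory.Ichino2022

namespace ExplicitLine

open MvPolynomial Finsupp FockHarmonics HarmonicParam

/-! ## §3 The `FockHarmonics` dictionary of the explicit model and Ichino's Lemma 7.10 as a THEOREM -/

section Dictionary

/-- **The joint-harmonics correspondence of the explicit model**, as an instance of the [Ich22] dictionary for a datum
`S` of signature `(p,q;r,s) = (1,0;2,1)`: `μ ⊠ μ′` occurs in `ℋ` iff there is a joint harmonic highest-weight vector
`f ∈ ℂ[z₁,z₂,w]` whose polynomial weights, SHIFTED by the printed vacuum weights `(r−s)/2 + m₀/2` (on `U(W)`) and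
`((p−q)/2; (q−p)/2) + n₀/2` (on `K′ = U(2) × U(1)`; the `U(1)_V` acts by MINUS the `w`-degree), are `(μ; μ′)`. [cite: Ichino2022ThetaReal, §7.5 Lemma 7.10] -/
noncomputable def explicitLine (S : SplittingDatum) (hr : S.r = 2) : FockHarmonics S where
  corresponds μ μ' := ∃ (f : Model) (k n₁ n₂ e : ℤ), IsHWVector f k n₁ n₂ e ∧
    (∀ i, μ.1 i = (k : ℚ) + ((S.r : ℚ) - S.s) / 2 + (S.m₀ : ℚ) / 2) ∧
    μ'.1 ⟨0, by omega⟩ = (n₁ : ℚ) + ((S.p : ℚ) - S.q) / 2 + (S.n₀ : ℚ) / 2 ∧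
    μ'.1 ⟨1, by omega⟩ = (n₂ : ℚ) + ((S.p : ℚ) - S.q) / 2 + (S.n₀ : ℚ) / 2 ∧
    (∀ j, μ'.2 j = -(e : ℚ) + ((S.q : ℚ) - S.p) / 2 + (S.n₀ : ℚ) / 2)

/-- Unfolding lemma for `corresponds`. [cite: Ichino2022ThetaReal, §7.5 Lemma 7.10] -/
theorem explicitLine_corresponds (S : SplittingDatum) (hr : S.r = 2) (μ : KWt S.p S.q) (μ' : KWt S.r S.s) :
    (explicitLine S hr).corresponds μ μ' ↔ ∃ (f : Model) (k n₁ n₂ e : ℤ), IsHWVector f k n₁ n₂ e ∧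
      (∀ i, μ.1 i = (k : ℚ) + ((S.r : ℚ) - S.s) / 2 + (S.m₀ : ℚ) / 2) ∧
      μ'.1 ⟨0, by omega⟩ = (n₁ : ℚ) + ((S.p : ℚ) - S.q) / 2 + (S.n₀ : ℚ) / 2 ∧
      μ'.1 ⟨1, by omega⟩ = (n₂ : ℚ) + ((S.p : ℚ) - S.q) / 2 + (S.n₀ : ℚ) / 2 ∧
      (∀ j, μ'.2 j = -(e : ℚ) + ((S.q : ℚ) - S.p) / 2 + (S.n₀ : ℚ) / 2) :=
  Iff.rfl

/-- The three admissible parameters of Lemma 7.10 at `(1,0;2,1)`: vacuum, `p⁺ = 1` with `a = (a₁)`, `p⁻ = 1` with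
`b = (b₁)`; given as the single constructor used below. [cite: Ichino2022ThetaReal, §7.5 Lemma 7.10] -/
def lineParam (S : SplittingDatum) (hp : S.p = 1) (hq : S.q = 0) (hr : S.r = 2) (hs : S.s = 1)
    (pp pm : ℕ) (hpp : pp + pm ≤ 1) (a : Fin pp → ℤ) (b : Fin pm → ℤ)
    (a_pos : ∀ i, 0 < a i) (b_neg : ∀ j, b j < 0) : HarmonicParam S where
  pp := pp
  pm := pm
  qp := 0
  qm := 0
  a := a
  b := b
  c := Fin.elim0
  d := Fin.elim0
  a_anti := fun i j _ => by
    have : i = j := Fin.ext (by have := i.isLt; have := j.isLt; omega)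
    rw [this]
  b_anti := fun i j _ => by
    have : i = j := Fin.ext (by have := i.isLt; have := j.isLt; omega)
    rw [this]
  c_anti := fun i => i.elim0
  d_anti := fun i => i.elim0
  a_pos := a_pos
  b_neg := b_neg
  c_pos := fun i => i.elim0
  d_neg := fun i => i.elim0
  hp := by omega
  hq := by omega
  hr := by omega
  hs := by omega

/-- **Ichino's Lemma 7.10 HOLDS in the explicit model `ℂ[z₁,z₂,w]` of `(U(1), U(2,1))`**, for every choice of the
splitting exponents `(m₀, n₀)` carried by `S`. [cite: Ichino2022ThetaReal, §7.5 Lemma 7.10] -/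
theorem lemma_7_10_explicitLine (S : SplittingDatum) (hp : S.p = 1) (hq : S.q = 0) (hr : S.r = 2)
    (hs : S.s = 1) : (explicitLine S hr).Lemma_7_10 := by
  intro μ μ'
  rw [explicitLine_corresponds]
  constructor
  · rintro ⟨f, k, n₁, n₂, e, hf, hμ, h0, h1, h2⟩
    rcases (isHWVector_iff f k n₁ n₂ e).mp hf with
      ⟨a, c, -, -, rfl, rfl, rfl, rfl⟩ | ⟨d, c, hd, -, -, rfl, rfl, rfl, rfl⟩
    · -- `f = c z₁^a`: vacuum (`a = 0`) or `p⁺ = 1`, `a₁ = a`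
      by_cases ha : a = 0
      · subst ha
        refine ⟨lineParam S hp hq hr hs 0 0 (by omega) Fin.elim0 Fin.elim0 (fun i => i.elim0) (fun j => j.elim0),
          ?_, ?_⟩
        · ext i
          · rw [hμ i, mu_fst_apply, pad_mid _ _ _ _ (by show 0 ≤ i.val; omega) (by show i.val < S.p - 0; omega)]
            push_cast; ring
          · exact (Fin.cast hq i).elim0
        · ext i
          · have hi : i.val = 0 ∨ i.val = 1 := by have := i.isLt; omega
            rcases hi with hi | hi
            · have : i = ⟨0, by omega⟩ := Fin.ext hi
              rw [this, h0, mu'_fst_apply, pad_mid _ _ _ _ (by show 0 ≤ 0; omega) (by show 0 < S.r - 0; omega)]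
              push_cast; ring
            · have : i = ⟨1, by omega⟩ := Fin.ext hi
              rw [this, h1, mu'_fst_apply, pad_mid _ _ _ _ (by show 0 ≤ 1; omega) (by show 1 < S.r - 0; omega)]
              push_cast; ring
          · rw [h2 i, mu'_snd_apply, pad_mid _ _ _ _ (by show 0 ≤ i.val; omega) (by show i.val < S.s - 0; omega)]
            push_cast; ring
      · have ha1 : 0 < (a : ℤ) := by omega
        refine ⟨lineParam S hp hq hr hs 1 0 (by omega) (fun _ => a) Fin.elim0 (fun _ => ha1) (fun j => j.elim0),
          ?_, ?_⟩
        · ext i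
          · rw [hμ i, mu_fst_apply, pad_head _ _ _ _ (by show i.val < 1; omega)]
            simp only [lineParam]
          · exact (Fin.cast hq i).elim0
        · ext i
          · have hi : i.val = 0 ∨ i.val = 1 := by have := i.isLt; omega
            rw [mu'_fst_apply]
            rcases hi with hi | hi
            · have : i = ⟨0, by omega⟩ := Fin.ext hi
              rw [this, h0, pad_head _ _ _ _ (by show 0 < 1; omega)]
              simp only [lineParam]
            · have : i = ⟨1, by omega⟩ := Fin.ext hi
              rw [this, h1, pad_mid _ _ _ _ (by show 1 ≤ 1; omega) (by show 1 < S.r - 0; omega)]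
              push_cast; ring
          · rw [h2 i, mu'_snd_apply, pad_mid _ _ _ _ (by show 0 ≤ i.val; omega)
              (by show i.val < S.s - 0; omega)]
            push_cast; ring
    · -- `f = c w^d`: `p⁻ = 1`, `b₁ = −d`
      have hd' : (-(d : ℤ)) < 0 := by omega
      refine ⟨lineParam S hp hq hr hs 0 1 (by omega) Fin.elim0 (fun _ => -(d : ℤ)) (fun i => i.elim0)
        (fun _ => hd'), ?_, ?_⟩
      · ext i
        · rw [hμ i, mu_fst_apply, pad_tail _ _ _ _ (by show 0 ≤ i.val; omega) (by show S.p - 1 ≤ i.val; omega)]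
          simp only [lineParam]
        · exact (Fin.cast hq i).elim0
      · ext i
        · rw [mu'_fst_apply, pad_mid _ _ _ _ (by show 0 ≤ i.val; omega) (by show i.val < S.r - 0; omega)]
          have hi : i.val = 0 ∨ i.val = 1 := by have := i.isLt; omega
          rcases hi with hi | hi
          · have : i = ⟨0, by omega⟩ := Fin.ext hi
            rw [this, h0]; push_cast; ring
          · have : i = ⟨1, by omega⟩ := Fin.ext hi
            rw [this, h1]; push_cast; ring
        · rw [h2 i, mu'_snd_apply, pad_tail _ _ _ _ (by show 0 ≤ i.val; omega) (by show S.s - 1 ≤ i.val; omega)]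
          simp only [lineParam]
          push_cast; ring
  · rintro ⟨P, hμ, hμ'⟩
    have hPq : P.qp + P.qm ≤ S.q := P.hq
    have hPs : P.pm + P.qp ≤ S.s := P.hs
    have hPp : P.pp + P.pm ≤ S.p := P.hp
    have hqm : P.qm = 0 := by omega
    have hqp : P.qp = 0 := by omega
    rcases Nat.lt_or_ge 0 P.pp with hpp | hpp
    · -- `p⁺ = 1`: the vector `z₁^{a₁}`
      have hpm : P.pm = 0 := by omega
      have ha := P.a_pos ⟨0, hpp⟩
      refine ⟨_, _, _, _, _, (isHWVector_iff _ _ _ _ _).mpr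
        (Or.inl ⟨(P.a ⟨0, hpp⟩).toNat, 1, one_ne_zero, rfl, rfl, rfl, rfl, rfl⟩), ?_, ?_, ?_, ?_⟩
      · intro i
        rw [hμ, mu_fst_apply, pad_head _ _ _ _ (by omega)]
        have : P.a ⟨i.val, by omega⟩ = P.a ⟨0, hpp⟩ := by congr 1; exact Fin.ext (by have := i.isLt; omega)
        rw [this]
        have : (((P.a ⟨0, hpp⟩).toNat : ℤ) : ℚ) = (P.a ⟨0, hpp⟩ : ℚ) := by
          exact_mod_cast Int.toNat_of_nonneg ha.le
        rw [this]
      · rw [hμ', mu'_fst_apply, pad_head _ _ _ _ (by simp; omega)]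
        have : (((P.a ⟨0, hpp⟩).toNat : ℤ) : ℚ) = (P.a ⟨0, hpp⟩ : ℚ) := by
          exact_mod_cast Int.toNat_of_nonneg ha.le
        rw [this]
      · rw [hμ', mu'_fst_apply, pad_mid _ _ _ _ (by simp; omega) (by simp; omega)]
        push_cast; ring
      · intro j
        rw [hμ', mu'_snd_apply, pad_mid _ _ _ _ (by omega) (by have := j.isLt; omega)]
        push_cast; ring
    · rcases Nat.lt_or_ge 0 P.pm with hpm | hpm
      · -- `p⁻ = 1`: the vector `w^{−b₁}`
        have hb := P.b_neg ⟨0, hpm⟩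
        have hd : 1 ≤ (-(P.b ⟨0, hpm⟩)).toNat := by omega
        refine ⟨_, _, _, _, _, (isHWVector_iff _ _ _ _ _).mpr
          (Or.inr ⟨(-(P.b ⟨0, hpm⟩)).toNat, 1, hd, one_ne_zero, rfl, rfl, rfl, rfl, rfl⟩), ?_, ?_, ?_, ?_⟩
        · intro i
          rw [hμ, mu_fst_apply, pad_tail _ _ _ _ (by omega) (by have := i.isLt; omega)]
          have : P.b ⟨i.val - (S.p - P.pm), by omega⟩ = P.b ⟨0, hpm⟩ := by
            congr 1; exact Fin.ext (by have := i.isLt; simp; omega)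
          rw [this]
          have hcast : (((-(P.b ⟨0, hpm⟩)).toNat : ℕ) : ℚ) = -((P.b ⟨0, hpm⟩ : ℤ) : ℚ) := by
            exact_mod_cast Int.toNat_of_nonneg (by omega : (0:ℤ) ≤ -(P.b ⟨0, hpm⟩))
          push_cast
          rw [hcast]; ring
        · rw [hμ', mu'_fst_apply, pad_mid _ _ _ _ (by simp; omega) (by simp; omega)]
          push_cast; ring
        · rw [hμ', mu'_fst_apply, pad_mid _ _ _ _ (by simp; omega) (by simp; omega)]
          push_cast; ring
        · intro j
          rw [hμ', mu'_snd_apply, pad_tail _ _ _ _ (by omega) (by have := j.isLt; omega)]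
          have : P.b ⟨j.val - (S.s - P.pm), by have := j.isLt; omega⟩ = P.b ⟨0, hpm⟩ := by
            congr 1; exact Fin.ext (by have := j.isLt; simp; omega)
          rw [this]
          have hcast : (((-(P.b ⟨0, hpm⟩)).toNat : ℕ) : ℚ) = -((P.b ⟨0, hpm⟩ : ℤ) : ℚ) := by
            exact_mod_cast Int.toNat_of_nonneg (by omega : (0:ℤ) ≤ -(P.b ⟨0, hpm⟩))
          push_cast
          rw [hcast]; ring
      · -- the vacuum: the constant `1 = z₁^0`
        have hpp0 : P.pp = 0 := by omega
        have hpm0 : P.pm = 0 := by omega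
        refine ⟨_, _, _, _, _, (isHWVector_iff _ _ _ _ _).mpr
          (Or.inl ⟨0, 1, one_ne_zero, rfl, rfl, rfl, rfl, rfl⟩), ?_, ?_, ?_, ?_⟩
        · intro i
          rw [hμ, mu_fst_apply, pad_mid _ _ _ _ (by omega) (by have := i.isLt; omega)]
          push_cast; ring
        · rw [hμ', mu'_fst_apply, pad_mid _ _ _ _ (by simp; omega) (by simp; omega)]
          push_cast; ring
        · rw [hμ', mu'_fst_apply, pad_mid _ _ _ _ (by simp; omega) (by simp; omega)]
          push_cast; ring
        · intro j
          rw [hμ', mu'_snd_apply, pad_mid _ _ _ _ (by omega) (by have := j.isLt; omega)]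
          push_cast; ring

end Dictionary

/-! ## §4 Group-level form of the weight conditions (bridge to a unitary torus action) -/

/-- **The four weight conditions of `IsHWVector`, read off the diagonal torus acting by CHARACTERS**: `f` has
`U(W)`-weight `k`, row weights `(n₁, n₂)` and `w`-degree `e` iff every unit-circle element `u` of the corresponding
one-parameter torus (`torusAct uW`, `torusAct (rowW a)`, `torusAct wDeg`: `X_i ↦ u^{weight} X_i`) acts on `f` by `u^k`,
`u^{n₁}`, `u^{n₂}`, `u^e` (`Literature.RingTheory.MvPolynomial.isWeightedHomogeneous_iff_torusAct`).  This is the form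
in which a constructed unitary representation (torus elements acting on Fock monomials by characters) meets
`IsHWVector`. [folklore] -/
theorem weights_iff_torusAct (f : Model) (k n₁ n₂ e : ℤ) :
    (IsWeightedHomogeneous uW f k ∧ IsWeightedHomogeneous (rowW 0) f n₁ ∧ IsWeightedHomogeneous (rowW 1) f n₂ ∧
        IsWeightedHomogeneous wDeg f e) ↔
      ((∀ u : ℂˣ, ‖(u : ℂ)‖ = 1 →
          Literature.RingTheory.MvPolynomial.torusAct uW u f = ((u ^ k : ℂˣ) : ℂ) • f) ∧
        (∀ u : ℂˣ, ‖(u : ℂ)‖ = 1 →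
          Literature.RingTheory.MvPolynomial.torusAct (rowW 0) u f = ((u ^ n₁ : ℂˣ) : ℂ) • f) ∧
        (∀ u : ℂˣ, ‖(u : ℂ)‖ = 1 →
          Literature.RingTheory.MvPolynomial.torusAct (rowW 1) u f = ((u ^ n₂ : ℂˣ) : ℂ) • f) ∧
        (∀ u : ℂˣ, ‖(u : ℂ)‖ = 1 →
          Literature.RingTheory.MvPolynomial.torusAct wDeg u f = ((u ^ e : ℂˣ) : ℂ) • f)) := by
  rw [Literature.RingTheory.MvPolynomial.isWeightedHomogeneous_iff_torusAct,
    Literature.RingTheory.MvPolynomial.isWeightedHomogeneous_iff_torusAct,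
    Literature.RingTheory.MvPolynomial.isWeightedHomogeneous_iff_torusAct,
    Literature.RingTheory.MvPolynomial.isWeightedHomogeneous_iff_torusAct]

end ExplicitLine

end Literature.RepresentationTheory.Ichino2022
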